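import Mathlib.Analysis.CStarAlgebra.GelfandNaimarkSegal
import Mathlib.Analysis.Matrix.Order
import Literature.MathematicalPhysics.QuantumLattice.InfiniteVolumeStates
import HarnessLib

/-!
# Discharged facts: infinite-volume states (`InfiniteVolumeStates`)

`Literature.MathematicalPhysics.QuantumLattice.InfiniteVolumeStates` defines an infinite-volume
state `ω : Literature.QLattice.InfVolState d q` of the quantum spin system on `ℤ^d` as a compatible
family of normalised positive linear functionals `ω_Λ = ω.expect Λ : 𝔄_Λ →ₗ[ℂ] ℂ` on the local
matrix algebras `𝔄_Λ = Op ↥Λ q` (positivity: `0 ≤ ω_Λ(Aᴴ A)` in `ComplexOrder`), and records the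
named facts

* `Literature.QLattice.InfVolState.expect_conjTranspose ω` — *states are Hermitian*,
  `ω_Λ(Aᴴ) = conj (ω_Λ A)` for every finite region `Λ` and every `A ∈ 𝔄_Λ`
  (Bratteli–Robinson I, §2.3.2: Lemma 2.3.10(a) `ω(A⋆B) = conj ω(B⋆A)` for a positive linear
  functional over a ⋆-algebra, with `B = 𝟙`; Prop. 2.3.11(a) `ω(A⋆) = conj ω(A)`);
* `Literature.QLattice.InfVolState.norm_expect_le ω` — *states are contractive*, `|ω_Λ(A)| ≤ ‖A‖`
  (L²-operator norm) for every finite region `Λ` and every `A ∈ 𝔄_Λ` (Bratteli–Robinson I,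
  Prop. 2.3.11: a positive linear functional on a C⋆-algebra is continuous with
  `‖ω‖ = lim_α ω(E_α)`, i.e. `‖ω‖ = ω(𝟙) = 1` for a state on a unital algebra; via the
  Cauchy–Schwarz inequality, Lemma 2.3.10(b));
* `Literature.MathematicalPhysics.QuantumLattice.embedOp_eq_localOp` — *isotony is a local-operator embedding*: for `Λ ⊆ Λ'` the
  isotony map `embedOp h : 𝔄_Λ → 𝔄_{Λ'}`, `A ↦ A ⊗ 𝟙_{Λ'∖Λ}` (Bratteli–Robinson II, §6.2.1:
  `𝔄_{Λ₁} ⊆ 𝔄_{Λ₂}` for `Λ₁ ⊆ Λ₂`), equals `localOp (subFinset Λ Λ') (transportOp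
  (subFinsetEquiv h) A)`, the embedding of `𝔄_Λ` at the copy `subFinset Λ Λ'` of `Λ` inside
  `↥Λ'`.

This file proves all three: `Literature.MathematicalPhysics.QuantumLattice.InfVolState.expect_conjTranspose_holds`,
`Literature.MathematicalPhysics.QuantumLattice.InfVolState.norm_expect_le_holds` and `Literature.MathematicalPhysics.QuantumLattice.embedOp_eq_localOp_holds`, so
that users holding `(h : ω.expect_conjTranspose)`, `(h : ω.norm_expect_le)` or
`(h : embedOp_eq_localOp)` can discharge the hypothesis with `ω.expect_conjTranspose_holds`,
`ω.norm_expect_le_holds`, `embedOp_eq_localOp_holds`.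

## Proof of `expect_conjTranspose_holds`

Printed proof (Bratteli–Robinson I, Lemma 2.3.10, p. 48): for `A, B ∈ 𝔄` and `λ ∈ ℂ`,
positivity gives `ω((λA + B)⋆(λA + B)) = |λ|² ω(A⋆A) + λ̄ ω(A⋆B) + λ ω(B⋆A) + ω(B⋆B) ≥ 0`, and
positivity of this quadratic form in `λ` forces (a) `ω(A⋆B) = conj ω(B⋆A)` (and (b) the
Cauchy–Schwarz inequality); `B = 𝟙` gives `ω(A⋆) = conj ω(A)` (Prop. 2.3.11(a)).

Here we run the same positivity argument in the equivalent "real on Hermitian elements" form,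
which needs only the two values `λ = ±1`: for `Hᴴ = H` the ⋆-algebra identity
`4H = (H + 𝟙)ᴴ(H + 𝟙) - (H - 𝟙)ᴴ(H - 𝟙)` and `ω((H ± 𝟙)ᴴ(H ± 𝟙)) ≥ 0` (hence real) give
`im ω(H) = 0` (`InfVolState.im_expect_eq_zero_of_isHermitian`); applied to the Hermitian
elements `A + Aᴴ` and `i(A - Aᴴ)` this says `im ω(Aᴴ) = -im ω(A)` and `re ω(Aᴴ) = re ω(A)`,
i.e. `ω(Aᴴ) = conj ω(A)`.

## Proof of `norm_expect_le_holds`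

Printed proof (Bratteli–Robinson I, Prop. 2.3.11, p. 49, specialised to a unital algebra and
the approximate identity `E_α = 𝟙`): by Cauchy–Schwarz (Lemma 2.3.10(b))
`|ω(𝟙⋆A)|² ≤ ω(𝟙⋆𝟙) ω(A⋆A) = ω(A⋆A)`, and by positivity `ω(A⋆A) ≤ M₊ ‖A‖²` with
`M₊ = sup {ω(B) : B ≥ 0, ‖B‖ ≤ 1} = ω(𝟙)` (as `0 ≤ B ≤ ‖B‖ 𝟙`); hence `|ω(A)| ≤ ω(𝟙)^{1/2}·
ω(𝟙)^{1/2} ‖A‖ = ‖A‖`.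

We prove this once for an arbitrary unital C⋆-algebra
(`Literature.MathematicalPhysics.QuantumLattice.PositiveLinearMap.norm_apply_le_of_map_one`: a Mathlib positive linear functional
`f : A →ₚ[ℂ] ℂ` with `f 1 = 1` satisfies `‖f a‖ ≤ ‖a‖`): the Cauchy–Schwarz step is
`norm_inner_le_norm` in Mathlib's pre-GNS space `PositiveLinearMap.PreGNS` (the semi-inner
product `⟪a, b⟫ = f(a⋆b)` on `A`, `Mathlib.Analysis.CStarAlgebra.GelfandNaimarkSegal`), and the
positivity step is Mathlib's `PositiveLinearMap.norm_apply_le_of_nonneg`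
(`‖f x‖ ≤ ‖f 1‖ ‖x‖` for `0 ≤ x`) with `‖a⋆a‖ = ‖a‖²`. It is then specialised to the local
algebras: for the Loewner order on `Op Λ q` (Mathlib's scoped `MatrixOrder`:
`0 ≤ A ↔ A.PosSemidef`, positive cone = closed additive span of `{Bᴴ B}`,
`Matrix.instStarOrderedRing`) the hypothesis `0 ≤ ω_Λ(Bᴴ B)` extends to the whole cone
(`InfVolState.expect_nonneg_of_nonneg`, the remark after Bratteli–Robinson I Def. 2.3.9), so
`ω_Λ` is a Mathlib `PositiveLinearMap`; and `Op Λ q` with its L²-operator norm is a C⋆-algebra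
— Mathlib provides the pieces as scoped instances (`Matrix.instL2OpNormedRing`,
`Matrix.instL2OpNormedAlgebra`, `Matrix.instCStarRing` in `Matrix.Norms.L2Operator`) but no
global `CStarAlgebra (Matrix n n ℂ)`, so the structure instance is assembled *locally inside the
proof* (no instance is registered).

## Proof of `embedOp_eq_localOp_holds`

There is nothing to prove in print: Bratteli–Robinson II §6.2.1 identifies `𝔄_{Λ₁}` with the
subalgebra `𝔄_{Λ₁} ⊗ 𝟙_{Λ₂∖Λ₁}` of `𝔄_{Λ₂} = 𝔄_{Λ₁} ⊗ 𝔄_{Λ₂∖Λ₁}` for `Λ₁ ⊆ Λ₂` (isotony), and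
the named fact records that the two Lean encodings of this one map `A ↦ A ⊗ 𝟙` agree — the
direct one `embedOp h` (`SpinSystem`, regions as subtypes `↥Λ ⊆ ↥Λ'` of `ℤ^d`) and the generic
local-operator embedding `localOp X` at the region `X = subFinset Λ Λ' ⊆ ↥Λ'` after relabelling
`A` along `subFinsetEquiv h : ↥Λ ≃ ↥X` (`transportOp`, a `Matrix.reindex`). Entrywise in the
product basis both are `⟨σ|·|τ⟩ = A (σ|_Λ) (τ|_Λ)` if `σ = τ` off `Λ`, else `0`: the side
conditions `∀ y : ↥Λ', ↑y ∉ Λ → σ y = τ y` and `∀ y, y ∉ subFinset Λ Λ' → σ y = τ y` agree by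
`mem_subFinset`, and the restricted configurations agree definitionally
(`(subFinsetEquiv h x : ↥Λ') = ⟨x, h x.2⟩`), so after `Matrix.ext` and `simp only
[embedOp, localOp, Matrix.of_apply, mem_subFinset]` the goal closes by `rfl`.

## References

* O. Bratteli, D. W. Robinson, *Operator Algebras and Quantum Statistical Mechanics 1*
  (2nd ed., Springer 1987), §2.3.2, Def. 2.3.9 (positive linear functionals; every positive
  element is `A⋆A`), Lemma 2.3.10 (Cauchy–Schwarz inequality; (a) `ω(A⋆B) = conj ω(B⋆A)`,
  (b) `|ω(A⋆B)|² ≤ ω(A⋆A) ω(B⋆B)`), Prop. 2.3.11 (positive ⇒ continuous, (a)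
  `ω(A⋆) = conj ω(A)`, (b) `|ω(A)|² ≤ ω(A⋆A) ‖ω‖`, and `‖ω‖ = lim_α ω(E_α)`), pp. 48–49.
  [BratteliRobinsonI1987]
* O. Bratteli, D. W. Robinson, *Operator Algebras and Quantum Statistical Mechanics 2.
  Equilibrium States. Models in Quantum Statistical Mechanics* (2nd ed., Springer 1997),
  §6.2.1 (quantum spin systems: the local algebras `𝔄_Λ = ⨂_{x∈Λ} M_q(ℂ)`, isotony
  `𝔄_{Λ₁} ⊆ 𝔄_{Λ₂}` for `Λ₁ ⊆ Λ₂` via `A ↦ A ⊗ 𝟙`, the quasi-local algebra).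
  [BratteliRobinsonII1997]
-/

open Matrix Complex
open scoped ComplexOrder

namespace Literature.MathematicalPhysics.QuantumLattice

open Literature.Probability.LatticeModels
open Literature.Probability.LatticeModels (Site)

variable {d q : ℕ}

namespace InfVolState

variable (ω : InfVolState d q)

/-- A state is real on Hermitian elements: `Hᴴ = H → im ω_Λ(H) = 0`. From positivity alone, via
the ⋆-algebra identity `4H = (H + 𝟙)ᴴ(H + 𝟙) - (H - 𝟙)ᴴ(H - 𝟙)` (both terms have expectation
`≥ 0`, hence real). Bratteli–Robinson I, §2.3.2, Lemma 2.3.10(a) with `B = 𝟙` / Prop. 2.3.11(a)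
restricted to self-adjoint `A`. [cite: BratteliRobinsonI1987, Lemma 2.3.10(a)] -/
theorem im_expect_eq_zero_of_isHermitian (Λ : Finset (Site d)) {H : Op ↥Λ q}
    (hH : H.IsHermitian) : (ω.expect Λ H).im = 0 := by
  have h₁ := ω.expect_nonneg Λ (H + 1)
  have h₂ := ω.expect_nonneg Λ (H - 1)
  rw [conjTranspose_add, conjTranspose_one, hH.eq] at h₁
  rw [conjTranspose_sub, conjTranspose_one, hH.eq] at h₂
  have key : (H + 1) * (H + 1) - (H - 1) * (H - 1) = 4 • H := by noncomm_ring
  have h : (4 • ω.expect Λ H).im =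
      (ω.expect Λ ((H + 1) * (H + 1))).im - (ω.expect Λ ((H - 1) * (H - 1))).im := by
    rw [← map_nsmul, ← key, map_sub, Complex.sub_im]
  simp only [← (Complex.nonneg_iff.1 h₁).2, ← (Complex.nonneg_iff.1 h₂).2, sub_zero,
    nsmul_eq_mul, Nat.cast_ofNat, Complex.mul_im, Complex.re_ofNat, Complex.im_ofNat, zero_mul,
    add_zero] at h
  linarith

/-- Discharge of the named fact `InfVolState.expect_conjTranspose`: **states are Hermitian**,
`ω_Λ(Aᴴ) = conj (ω_Λ A)`. Printed proof (Bratteli–Robinson I, Lemma 2.3.10): positivity of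
`λ ↦ ω((λA + B)⋆(λA + B))` forces `ω(A⋆B) = conj ω(B⋆A)`; take `B = 𝟙` (Prop. 2.3.11(a)). Here:
`A + Aᴴ` and `i(A - Aᴴ)` are Hermitian, so `ω` is real on both
(`im_expect_eq_zero_of_isHermitian`), which says `im ω(Aᴴ) = -im ω(A)` and `re ω(Aᴴ) = re ω(A)`.
[cite: BratteliRobinsonI1987, §2.3.2, Lemma 2.3.10(a) and Prop. 2.3.11(a)] -/
theorem expect_conjTranspose_holds : ω.expect_conjTranspose := by
  intro Λ A
  have h₁ : (ω.expect Λ (A + Aᴴ)).im = 0 :=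
    ω.im_expect_eq_zero_of_isHermitian Λ
      (by rw [IsHermitian, conjTranspose_add, conjTranspose_conjTranspose, add_comm])
  have h₂ : (ω.expect Λ (I • (A - Aᴴ))).im = 0 :=
    ω.im_expect_eq_zero_of_isHermitian Λ
      (by rw [IsHermitian, conjTranspose_smul, conjTranspose_sub, conjTranspose_conjTranspose,
        Complex.star_def, Complex.conj_I, neg_smul, ← smul_neg, neg_sub])
  rw [map_add, Complex.add_im] at h₁
  rw [map_smul, map_sub, smul_eq_mul, Complex.mul_im, Complex.I_re, Complex.I_im, zero_mul,
    one_mul, zero_add, Complex.sub_re] at h₂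
  apply Complex.ext
  · rw [Complex.star_def, Complex.conj_re]; linarith
  · rw [Complex.star_def, Complex.conj_im]; linarith

/-! ### States are contractive: `|ω_Λ(A)| ≤ ‖A‖` -/

open scoped InnerProductSpace in
/-- **Normalised positive functionals on a unital C⋆-algebra are contractive**: if
`f : A →ₚ[ℂ] ℂ` is a positive linear functional with `f 1 = 1`, then `‖f a‖ ≤ ‖a‖` for all `a`
(so `‖f‖ = f(𝟙) = 1`). Bratteli–Robinson I, §2.3.2: by the Cauchy–Schwarz inequality
Lemma 2.3.10(b), `|f(𝟙⋆ a)|² ≤ f(𝟙⋆𝟙) f(a⋆a) = f(a⋆a)` (here: `norm_inner_le_norm` in Mathlib's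
pre-GNS space `PositiveLinearMap.PreGNS`, whose semi-inner product is `⟪a, b⟫ = f(a⋆ b)`), and by
positivity `f(a⋆a) ≤ f(𝟙) ‖a⋆a‖ = ‖a‖²` since `a⋆a ≤ ‖a⋆a‖ 𝟙` (Mathlib's
`PositiveLinearMap.norm_apply_le_of_nonneg`); this is Prop. 2.3.11(b) together with its last
assertion `‖f‖ = lim_α f(E_α)` for the approximate identity `E_α = 𝟙`. (Namespace
`Literature.PositiveLinearMap`, not Mathlib's `PositiveLinearMap`, to avoid a future name clash.)
[cite: BratteliRobinsonI1987, Prop. 2.3.11] -/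
theorem _root_.Literature.MathematicalPhysics.QuantumLattice.PositiveLinearMap.norm_apply_le_of_map_one {A : Type*} [CStarAlgebra A]
    [PartialOrder A] [StarOrderedRing A] (f : A →ₚ[ℂ] ℂ) (h1 : f 1 = 1) (a : A) :
    ‖f a‖ ≤ ‖a‖ := by
  -- Cauchy–Schwarz in the pre-GNS space: `‖f (1⋆ a)‖ ≤ ‖[1]‖ ‖[a]‖ = ‖[a]‖`
  have hcs := norm_inner_le_norm (𝕜 := ℂ) (f.toPreGNS 1) (f.toPreGNS a)
  rw [PositiveLinearMap.preGNS_inner_def] at hcs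
  simp only [PositiveLinearMap.ofPreGNS_toPreGNS, star_one, one_mul] at hcs
  have hn1 : ‖f.toPreGNS 1‖ = 1 := by
    rw [PositiveLinearMap.preGNS_norm_def]
    simp [h1]
  rw [hn1, one_mul] at hcs
  refine hcs.trans ?_
  -- `‖[a]‖² = re f(a⋆a) ≤ ‖f(a⋆a)‖ ≤ ‖f 1‖ ‖a⋆a‖ = ‖a‖²`
  have h0 : 0 ≤ f (star a * a) := f.map_nonneg (star_mul_self_nonneg a)
  rw [← sq_le_sq₀ (norm_nonneg _) (norm_nonneg _), PositiveLinearMap.preGNS_norm_def,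
    PositiveLinearMap.ofPreGNS_toPreGNS, Real.sq_sqrt (Complex.nonneg_iff.1 h0).1]
  calc (f (star a * a)).re ≤ ‖f (star a * a)‖ := Complex.re_le_norm _
    _ ≤ ‖f 1‖ * ‖star a * a‖ := f.norm_apply_le_of_nonneg _ (star_mul_self_nonneg a)
    _ = ‖a‖ ^ 2 := by rw [h1, norm_one, one_mul, CStarRing.norm_star_mul_self, sq]

open scoped MatrixOrder in
/-- The local states are positive on the whole positive cone: `0 ≤ A → 0 ≤ ω_Λ(A)` for `A`
positive semidefinite (Loewner order `Matrix.instPartialOrder`, `open scoped MatrixOrder`).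
Bratteli–Robinson I, §2.3.2, remark after Def. 2.3.9: every positive element of a C⋆-algebra is
of the form `Bᴴ B`, so positivity on the `Bᴴ B` (`expect_nonneg`) is positivity (for matrices,
Mathlib's `Matrix.instStarOrderedRing`: the cone is the closed additive span of `{Bᴴ B}`, along
which `0 ≤ ω_Λ` propagates by additivity). [cite: BratteliRobinsonI1987, Def. 2.3.9] -/
theorem expect_nonneg_of_nonneg (Λ : Finset (Site d)) {A : Op ↥Λ q} (hA : 0 ≤ A) :
    0 ≤ ω.expect Λ A := by
  rw [StarOrderedRing.nonneg_iff] at hA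
  induction hA using AddSubmonoid.closure_induction with
  | mem x hx =>
    obtain ⟨B, rfl⟩ := hx
    exact ω.expect_nonneg Λ B
  | zero => simp
  | add x y _ _ hx hy =>
    rw [map_add]
    exact add_nonneg hx hy

open scoped MatrixOrder Matrix.Norms.L2Operator in
/-- **Discharge of `InfVolState.norm_expect_le`**: `|ω_Λ(A)| ≤ ‖A‖` (L²-operator norm) for every
region `Λ` and every local observable `A`, from positivity and normalisation of `ω_Λ`.
Bratteli–Robinson I, Prop. 2.3.11 (with Lemma 2.3.10): a positive linear functional on a unital
C⋆-algebra is continuous with `‖ω‖ = ω(𝟙)`; applied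
(`Literature.MathematicalPhysics.QuantumLattice.PositiveLinearMap.norm_apply_le_of_map_one`) to `ω_Λ`, a Mathlib `PositiveLinearMap` by
`expect_nonneg_of_nonneg`, on the finite-dimensional C⋆-algebra `𝔄_Λ = Op Λ q` with its
L²-operator norm (a local `CStarAlgebra` structure assembled from Mathlib's scoped
`Matrix.Norms.L2Operator` instances). [cite: BratteliRobinsonI1987, Prop. 2.3.11] -/
theorem norm_expect_le_holds : ω.norm_expect_le := by
  intro Λ A
  letI : CStarAlgebra (Op ↥Λ q) := {}
  exact Literature.MathematicalPhysics.QuantumLattice.PositiveLinearMap.norm_apply_le_of_map_one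
    (.mk₀ (ω.expect Λ) fun _ hB => ω.expect_nonneg_of_nonneg Λ hB) (ω.expect_one Λ) A

end InfVolState

/-! ### Isotony as a local-operator embedding -/

/-- **Discharge of `embedOp_eq_localOp`**: for `Λ ⊆ Λ'` and `A ∈ 𝔄_Λ`, the isotony map
`embedOp h : 𝔄_Λ → 𝔄_{Λ'}` *is* the local-operator embedding `localOp (subFinset Λ Λ')` of `A`
transported along `subFinsetEquiv h : ↥Λ ≃ ↥(subFinset Λ Λ')`. Both sides are the matrix of
`A ⊗ 𝟙_{Λ'∖Λ}` in the product basis, `⟨σ|·|τ⟩ = A (σ|_Λ) (τ|_Λ)` if `σ = τ` off `Λ` and `0`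
otherwise; once `mem_subFinset` identifies the two side conditions the entries agree
definitionally (`transportOp` is `Matrix.reindex` along `σ ↦ σ ∘ (subFinsetEquiv h)⁻¹`, and
`(subFinsetEquiv h x : ↥Λ') = ⟨x, h x.2⟩`). Bratteli–Robinson II §6.2.1 (isotony
`𝔄_{Λ₁} ⊆ 𝔄_{Λ₂}` for `Λ₁ ⊆ Λ₂`, `A ↦ A ⊗ 𝟙`). [cite: BratteliRobinsonII1997, §6.2.1] -/
theorem embedOp_eq_localOp_holds : embedOp_eq_localOp (d := d) (q := q) := by
  intro Λ Λ' h A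
  ext σ τ
  simp only [embedOp, localOp, of_apply, mem_subFinset]
  rfl

end Literature.MathematicalPhysics.QuantumLattice
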